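import Mathlib
import Summits.KontsevichZagierPeriods.KontsevichZagierPeriods.Theorems.SoloInformedScaleMaps
import HarnessLib
import HarnessLib.Audit

/-!
# SoloInformed — THE SCALE BAND STEP (THEOREM XLIX): `[A] − [B] ∈ KZ.relations`

Solo programme `solo-KontsevichZagierPeriods-informed`, session s48 (PROGRAMME L, file 4).

For a scale datum `T` (active slot `i`, `Φ = P/Q`, passive `ω`, `C`):

  `A = [D ∩ {ω < xᵢ}, Φ/(C(1 − ω))]`,  `B = [D, (Φ(x) − ω·Φ(x|xᵢ ↦ ωxᵢ))/(C(1 − ω))]`,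

**THEOREM** `SoloInformedScaleDatum.scale : of T.repA − of T.repB ∈ KZ.relations`.

The four moves, with ONE primitive `F(y,λ) = λΦ(y|yᵢ ↦ λyᵢ)/(C(1−ω))` and ONE band integrand
`g = ∂F/∂λ` (Euler: `yᵢ∂ᵢ = λ∂_λ` on functions of `λyᵢ`):
* rule (3): `[M] − [A]`, `M = [bandM, g]`, fibres `λ ∈ [0,1]` over `D_A`, `∫ = F(z,1) − F(z,0) = f_A`;
* rule (2): `[M] − [M.reindex e]`, the coordinate swap `zᵢ ↔ λ`;
* rule (1): `[M.reindex e] − [N]`, equal integrands (`g ∘ e = g`), domains equal up to the null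
  walls `{yᵢ ∈ {0,1}}`, `{λ ∈ {1, ω}}`;
* rule (3): `[N] − [B]`, `N = [bandN, g]`, fibres `λ ∈ [ω(y), 1]` over `D`, `∫ = F(y,1) − F(y,ω) = f_B`.
Integrability flows from the single hypothesis `integrableOn_fB`: `N` by Tonelli (`g ≥ 0`,
`soloInformed_integrableOn_band`), `M` by the measure-preserving swap, `A` by Fubini
(`soloInformed_integrableOn_base`).

This is the rule-(3) engine of the ⋆-regularised sum formulae: `Σₙ aₙ bⁿ⁻¹·(1 − bⁿ)/(1 − b)`-type
identities (Kaneko–Yamamoto's integral–series identity, Hoffman's relations) become four KZ moves.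

Place in the programme (the files that consume this one): `SoloInformedHookChain` iterates the
step along the hanging variables of the hook identities (PROGRAMME LIII: `SoloInformedHookStage` →
`SoloInformedHookChain` → `SoloInformedHookB` → `SoloInformedHook`), and `SoloInformedHoffmanB`
starts the single-step chain of Hoffman's relation (`SoloInformedHoffmanChart`,
`SoloInformedHoffmanPieces`, `SoloInformedHoffman`).  The converse integrability transfer
(`A`-side ⟹ `B`-side) needed for the iteration is `SoloInformedScaleIntegrable`.

References: Kontsevich–Zagier 2001 §1.2 rules (1)–(3) [KontsevichZagier2001]; M. Kaneko,
S. Yamamoto, arXiv:1605.03117 Thm 4.1; M. Hoffman, Pacific J. Math. 152 (1992) Thm 5.1.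
-/

noncomputable section

open MeasureTheory Set MvPolynomial
open Literature.ModelTheory.ExponentialFields Literature.NumberTheory.Transcendental
open Literature.NumberTheory.Transcendental.KZ

namespace Summit.KontsevichZagierPeriods.KontsevichZagierPeriods.Theorems

namespace SoloInformedScaleDatum

variable {n : ℕ} (T : SoloInformedScaleDatum n)

/-! ## 1. Integrability -/

/-- `bandN` in the literal band shape over `D` with `a = ω`, `b = 1`. -/
theorem bandN_eq : T.bandN = {z : Fin (n + 1) → ℝ | (Fin.init z : Fin n → ℝ) ∈ T.D ∧
    T.ω (Fin.init z) ≤ z (Fin.last n) ∧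
    z (Fin.last n) ≤ (fun _ : Fin n → ℝ => (1 : ℝ)) (Fin.init z)} := rfl

/-- `bandM` in the literal band shape over `D_A` with `a = 0`, `b = 1`. -/
theorem bandM_eq : T.bandM = {z : Fin (n + 1) → ℝ | (Fin.init z : Fin n → ℝ) ∈ T.DA ∧
    (fun _ : Fin n → ℝ => (0 : ℝ)) (Fin.init z) ≤ z (Fin.last n) ∧
    z (Fin.last n) ≤ (fun _ : Fin n → ℝ => (1 : ℝ)) (Fin.init z)} := rfl

/-- **`g` is integrable on `bandN`** (Tonelli: `g ≥ 0`, fibre integrals `= f_B ∈ L¹(D)`). -/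
theorem integrableOn_g_bandN : IntegrableOn T.g T.bandN :=
  soloInformed_integrableOn_band (τ := T.D) (a := T.ω) (b := fun _ => (1 : ℝ)) (F := T.F)
    (g := T.g) T.measurableSet_D T.measurableSet_bandN T.bandN_eq
    (fun _ hx => (ω_lt_one hx).le)
    (fun _ hx => T.continuousOn_F hx (ω_pos hx).le le_rfl)
    (fun _ hx _ ht => T.hasDerivAt_F hx ⟨(ω_pos hx).le.trans ht.1.le, ht.2.le⟩)
    (fun _ hx _ ht => T.g_nonneg hx ⟨(ω_pos hx).trans ht.1, ht.2⟩)
    T.aestronglyMeasurable_g_bandN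
    (T.integrableOn_fB.congr_fun (fun _ hx => T.F_one_sub_F_ω hx) T.measurableSet_D)

/-- **`g` is integrable on `bandM`** (transport along the measure-preserving swap, the two bands
agreeing up to null walls). -/
theorem integrableOn_g_bandM : IntegrableOn T.g T.bandM := by
  have hW : MeasurePreserving (MeasurableEquiv.piCongrLeft (fun _ : Fin (n + 1) => ℝ) T.e.symm)
      (volume : Measure (Fin (n + 1) → ℝ)) (volume : Measure (Fin (n + 1) → ℝ)) :=
    volume_measurePreserving_piCongrLeft (fun _ : Fin (n + 1) => ℝ) T.e.symm
  have happ : ∀ w : Fin (n + 1) → ℝ,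
      MeasurableEquiv.piCongrLeft (fun _ : Fin (n + 1) => ℝ) T.e.symm w = fun j => w (T.e j) := by
    intro w; ext j
    simpa using MeasurableEquiv.piCongrLeft_apply_apply T.e.symm (β := fun _ : Fin (n + 1) => ℝ)
      w (T.e j)
  have hpre : (MeasurableEquiv.piCongrLeft (fun _ : Fin (n + 1) => ℝ) T.e.symm) ⁻¹' T.bandM =
      {w | (fun j => w (T.e j)) ∈ T.bandM} := by
    ext w; rw [mem_preimage, happ]; rfl
  have hcomp : T.g ∘ (MeasurableEquiv.piCongrLeft (fun _ : Fin (n + 1) => ℝ) T.e.symm) = T.g := by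
    funext w; rw [Function.comp_apply, happ, g_comp_e]
  have hae : {w : Fin (n + 1) → ℝ | (fun j => w (T.e j)) ∈ T.bandM} =ᵐ[volume] T.bandN :=
    ae_eq_set.2 ⟨T.null_M_diff_N, T.null_N_diff_M⟩
  have h1 : IntegrableOn T.g {w | (fun j => w (T.e j)) ∈ T.bandM} :=
    T.integrableOn_g_bandN.congr_set_ae hae
  have h2 : IntegrableOn (T.g ∘ (MeasurableEquiv.piCongrLeft (fun _ : Fin (n + 1) => ℝ) T.e.symm))
      ((MeasurableEquiv.piCongrLeft (fun _ : Fin (n + 1) => ℝ) T.e.symm) ⁻¹' T.bandM) := by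
    rw [hcomp, hpre]; exact h1
  exact (hW.integrableOn_comp_preimage
    (MeasurableEquiv.piCongrLeft (fun _ : Fin (n + 1) => ℝ) T.e.symm).measurableEmbedding).mp h2

/-- **`f_A` is integrable on `D_A`** (Fubini: fibre integrals of `g ∈ L¹(bandM)`). -/
theorem integrableOn_fA : IntegrableOn T.fA T.DA :=
  soloInformed_integrableOn_base (τ := T.DA) (B := T.bandM) (a := fun _ => (0 : ℝ))
    (b := fun _ => (1 : ℝ)) (F := T.F) (g := T.g) (f := T.fA)
    T.measurableSet_DA T.measurableSet_bandM T.bandM_eq (fun _ _ => zero_le_one)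
    (fun _ hx => T.continuousOn_F hx.1 le_rfl le_rfl)
    (fun _ hx _ ht => T.hasDerivAt_F hx.1 ⟨le_of_lt ht.1, le_of_lt ht.2⟩)
    T.integrableOn_g_bandM (fun x _ => T.F_one_sub_F_zero x)

/-! ## 2. The representations -/

/-- **`B = [D, (Φ − ωΦ(·|xᵢ ↦ ωxᵢ))/(C(1 − ω))]`.** -/
def repB : IntegralRep n where
  domain := T.D
  integrand := T.fB
  isSemialgebraic_domain := T.isSemialgebraic_D
  isSemialgebraicFunOn_integrand := T.isSemialgebraicFunOn_fB
  integrableOn := T.integrableOn_fB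

/-- **`A = [D ∩ {ω < xᵢ}, Φ/(C(1 − ω))]`.** -/
def repA : IntegralRep n where
  domain := T.DA
  integrand := T.fA
  isSemialgebraic_domain := T.isSemialgebraic_DA
  isSemialgebraicFunOn_integrand := T.isSemialgebraicFunOn_fA
  integrableOn := T.integrableOn_fA

/-- `N = [bandN, g]`. -/
def repN : IntegralRep (n + 1) where
  domain := T.bandN
  integrand := T.g
  isSemialgebraic_domain := T.isSemialgebraic_bandN
  isSemialgebraicFunOn_integrand := T.isSemialgebraicFunOn_g_bandN
  integrableOn := T.integrableOn_g_bandN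

/-- `M = [bandM, g]`. -/
def repM : IntegralRep (n + 1) where
  domain := T.bandM
  integrand := T.g
  isSemialgebraic_domain := T.isSemialgebraic_bandM
  isSemialgebraicFunOn_integrand := T.isSemialgebraicFunOn_g_bandM
  integrableOn := T.integrableOn_g_bandM

/-- Auxiliary (scale step): `repA_domain`. -/
@[simp] theorem repA_domain : T.repA.domain = T.D ∩ {x | T.ω x < x T.i} := rfl
/-- Auxiliary (scale step): `repA_integrand`. -/
@[simp] theorem repA_integrand : T.repA.integrand = T.fA := rfl
/-- Auxiliary (scale step): `repB_domain`. -/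
@[simp] theorem repB_domain : T.repB.domain = T.D := rfl
/-- Auxiliary (scale step): `repB_integrand`. -/
@[simp] theorem repB_integrand : T.repB.integrand = T.fB := rfl

/-- Auxiliary (scale step): the constant `0` is semialgebraic. -/
theorem isSemialgebraicFunOn_zero {s : Set (Fin n → ℝ)} (hs : IsSemialgebraic ℚ s) :
    IsSemialgebraicFunOn ℚ s fun _ : Fin n → ℝ => (0 : ℝ) :=
  (isSemialgebraicFunOn_aeval hs (0 : MvPolynomial (Fin n) ℚ)).congr fun x _ => by simp
/-- Auxiliary (scale step): the constant `1` is semialgebraic. -/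
theorem isSemialgebraicFunOn_one {s : Set (Fin n → ℝ)} (hs : IsSemialgebraic ℚ s) :
    IsSemialgebraicFunOn ℚ s fun _ : Fin n → ℝ => (1 : ℝ) :=
  (isSemialgebraicFunOn_aeval hs (1 : MvPolynomial (Fin n) ℚ)).congr fun x _ => by simp

/-! ## 3. The four moves -/

/-- **Rule (3):** `[M] − [A] ∈ relations` (fibres `λ ∈ [0,1]`, `∫ = F(z,1) − F(z,0) = f_A(z)`). -/
theorem move_MA : of T.repM - of T.repA ∈ relations :=
  newtonLeibnizRel_subset_relations ⟨n, T.repM, T.repA, fun _ => (0 : ℝ), fun _ => (1 : ℝ), T.F,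
    T.isSemialgebraicFunOn_F_bandM, isSemialgebraicFunOn_zero T.isSemialgebraic_DA,
    isSemialgebraicFunOn_one T.isSemialgebraic_DA, fun _ _ => zero_le_one, rfl,
    fun _ hx => T.continuousOn_F hx.1 le_rfl le_rfl,
    fun _ hx _ ht => T.hasDerivAt_F hx.1 ⟨le_of_lt ht.1, le_of_lt ht.2⟩,
    fun x _ => T.F_one_sub_F_zero x, rfl⟩

/-- **Rule (2):** `[M] − [M.reindex e] ∈ relations` (the swap `zᵢ ↔ λ`). -/
theorem move_MMe : of T.repM - of (T.repM.reindex T.e) ∈ relations :=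
  of_sub_of_reindex_mem_relations T.repM T.e

/-- **Rule (1):** `[M.reindex e] − [N] ∈ relations` (same integrand, domains equal a.e.). -/
theorem move_MeN : of (T.repM.reindex T.e) - of T.repN ∈ relations :=
  of_sub_of_mem_relations_of_null _ _ T.null_M_diff_N T.null_N_diff_M fun w _ => T.g_comp_e w

/-- **Rule (3):** `[N] − [B] ∈ relations` (fibres `λ ∈ [ω(y),1]`, `∫ = F(y,1) − F(y,ω) = f_B(y)`). -/
theorem move_NB : of T.repN - of T.repB ∈ relations :=
  newtonLeibnizRel_subset_relations ⟨n, T.repN, T.repB, T.ω, fun _ => (1 : ℝ), T.F,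
    T.isSemialgebraicFunOn_F_bandN, T.isSemialgebraicFunOn_ω,
    isSemialgebraicFunOn_one T.isSemialgebraic_D, fun _ hx => (ω_lt_one hx).le, rfl,
    fun _ hx => T.continuousOn_F hx (ω_pos hx).le le_rfl,
    fun _ hx _ ht => T.hasDerivAt_F hx ⟨(ω_pos hx).le.trans (le_of_lt ht.1), le_of_lt ht.2⟩,
    fun _ hx => T.F_one_sub_F_ω hx, rfl⟩

/-- **THE SCALE BAND STEP (THEOREM XLIX, in every dimension).**
`[D ∩ {ω < xᵢ}, Φ/(C(1−ω))] − [D, (Φ − ωΦ(·|xᵢ ↦ ωxᵢ))/(C(1−ω))] ∈ KZ.relations`, as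
`−(M−A) + (M−M^e) + (M^e−N) + (N−B)`. [Kontsevich–Zagier 2001 §1.2, rules (1),(2),(3)] -/
theorem scale : of T.repA - of T.repB ∈ relations := by
  have h : of T.repA - of T.repB = -(of T.repM - of T.repA) + (of T.repM - of (T.repM.reindex T.e))
      + (of (T.repM.reindex T.e) - of T.repN) + (of T.repN - of T.repB) := by abel
  rw [h]
  exact relations.add_mem (relations.add_mem (relations.add_mem (relations.neg_mem T.move_MA)
    T.move_MMe) T.move_MeN) T.move_NB

/-- The step as an equivalence of representations. -/
theorem scale_equivalent : Equivalent T.repA T.repB := T.scale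

end SoloInformedScaleDatum

end Summit.KontsevichZagierPeriods.KontsevichZagierPeriods.Theorems
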